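import Mathlib.Analysis.Complex.Basic
import Mathlib.Analysis.SpecialFunctions.Sqrt
import Mathlib.LinearAlgebra.Dual.Defs
import Mathlib.Algebra.Group.Subgroup.Basic
import Mathlib.Algebra.BigOperators.Group.Finset.Basic
import Literature.NumberTheory.Automorphic.Shelstad1979.Correspondences   -- ★ `TemperedSetting` (𝒞(G), tempered dual, χ_φ, F_Θ, 2q_G)
import HarnessLib

/-!
# Shelstad, *L-indistinguishability for real groups* (Math. Ann. 259, 1982) — §3 «Orbital integrals»: (3.1) the
# (G,H)-orbital-integral transfer factors `Δ_(T,η)`, (3.5) choice of signs (PROPOSITION 3.5.3, THEOREM 3.5.4), (3.6) the two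
# admissible families attached to `ξ`, (3.7) `q(G,H)` (PROPOSITION 3.7.1, COROLLARY 3.7.2); §4 «Lifting characters»: LEMMA 4.0.1,
# THEOREM 4.1.1, COROLLARY 4.1.2, LEMMA 4.2.1, PROPOSITION 4.2.3, LEMMA 4.3.1, THEOREM 4.3.2, LEMMA 4.3.5, DEFINITION 4.3.6,
# LEMMA 4.3.7, and (4.7) «Theorem 4.1.1 as a set of character identities»

Topic `NumberTheory/Automorphic/Shelstad1982`; namespace `Literature.NumberTheory.Automorphic.Shelstad1982.TransferAndLifting`.
STATEMENTS ONLY (a typing carpet): `structure`s (data-only dictionaries, no field asserts a proposition) and `def`s with bodies;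
**no theorem, no proof, no `sorry`, no `axiom`, no `instance`, no `notation`**.  Source: D. Shelstad, *L-indistinguishability for
real groups*, Math. Ann. **259** (1982) 385–430 [Shelstad1982], read on the GDZ scan PPN235181684_0259 ∕ LOG_0060 (page images,
printed pp. 385–430; every page pin below is a PRINTED Math. Ann. page, every display was read on the page image, not on the OCR).

## What the consumers want, and the dress

The tree cites [Shelstad1982] without locator in ★ `Rogawski1990.ArchEndoscopicTransferCompatible` ∕ `…OfOneSystem` and in the H413
lines `F0_P3c_StubN9Paydown` (organ `stub_N9schwartzTransfer`), `F0_P3a_ArchTransfers{Canonical,Singular}Paydown`,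
`Theorems/F0P3aArchTransfersCanonicalOfStubs` for TWO things: (a) «a Schwartz `f` on `G(ℝ)` has a Schwartz `f^H` on `H(ℝ)` with
`Δ`-matching orbital integrals» — this is print's DEFINITION (3.1.1) of a *set of (G,H)-orbital-integral transfer factors* together
with the EXISTENCE statement of (3.6) («to each admissible embedding `ξ : ᴸH ↪ ᴸG` of unitary type are attached two admissible
families of transfer factors, `{Δ_(T,η)}` and `{−Δ_(T,η)}`»); (b) the dual character identities «`Θ^st_{φ_H}(f^H) = Σ_π Δ(φ_H, π) Θ_π(f)`»
— print's THEOREM 4.1.1 ∕ (4.7).  The bridge B2∞ of the TN socket map («`∃ c, archExplicitTransferFactor = c • Δ^{(ℝ)}_{Shelstad}`», the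
instance of ★ `LanglandsShelstad1990Descent.Consequences.LanglandsShelstad1990Descent_2_6_A_archimedeanTransferFactor … ΔR`) needs
Shelstad's real transfer factor `Δ_(T,η) = (−1)^{q(G,H)} ε(T,η) Λ_(T,η) Δ⁰_(T,η)` as a NAMED object: it is `shelstadDelta` below, with
its «discriminant» factor `Δ⁰_(T,η)` (`discriminantFactor`) DEFINED by the printed root product of p. 394 and `q(G,H)` (`qGH`)
DEFINED by (3.7).

Mathlib has no real reductive groups, Cartan subgroups, Harish-Chandra Schwartz space, `κ`-orbital integrals, L-packets or
Langlands parameters.  As in the sibling ★ `Shelstad1979.Correspondences` (whose dictionary `TemperedSetting G` — `G_reg`, `𝒞(G)`,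
the tempered dual, `χ_φ`, `F_Θ`, `2q_G` — is REUSED here for both `G` and `H`), the objects print takes from [14–16] and from §2
of this paper (the set `𝒯_H(G)` of pairs `(T, η)` with their quasicharacters `κ`, «`γ′` originates from `γ` via `(T,η)`», the
`κ`-orbital integrals `Φ^{(T,κ)}_f(γ, dt, dg)` of [15], the roots of `(G, T)` with the positive system determined by `(η, B*)`, the
groups `Ω₀(G,T) ∩ Ω^{(κ)}(G,T)`, the correction characters `Λ_(T,η)` attached to `ξ` by (3.3.3)–(3.1.5), the signs `ε(m, n)` of
[15] on adjacent Cartan subgroups of a framework, the L-packets `Π_φ` and the distributions `Θ(ωμ, λ, ωΨ)`) are the FIELDS of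
explicit data-only dictionaries `TransferSetting G H` (§3), `SignFramework D` (§3.5) and `LiftingSetting G H` (§4); the §2 ∕ (3.2)–(3.4)
set-up itself is the companion carpet `…/Shelstad1982/EndoscopicData.lean` (block B, TN-t02) and is NOT restated here.
**Every numbered item is a `def … : Prop` PREDICATE on an explicit dictionary** (print's theorem = the predicate HOLDS for print's
data; a consumer takes `(h : Shelstad1982_4_1_1_liftOfStableCharacter L)` for ITS instantiation; `∀ D, …` is never claimed; no
debt is created), except the objects print DEFINES, which are `def`s with their printed bodies: `discriminantFactor` (p. 394),
`IsTransferFactorFamily` ((3.1.1) p. 393), `IsAdmissibleVia`∕`IsAdmissible` ((3.1.3)–(3.1.4) p. 394), `shelstadDelta` ((3.3) p. 397,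
§4 p. 402, §5 p. 414), `qGH` ((3.7) pp. 401–402), `IsLift` (§4 p. 402), `IsRelevant` ((4.1) p. 402), `IsTotallyCompact` (Def. 4.3.6).

## Index (print item ↦ declaration)

| print | declaration | kind |
|---|---|---|
| §3.1 p. 393: `𝒞(G)`, `𝒞(H)`, `𝒯_H(G)`, `Φ^{(T,κ)}_f`, `Φ^{(T′,1)}_{f′}`, «originates via `(T,η)`», roots∕`κ(α^∨)`∕`Ω₀ ∩ Ω^{(κ)}`, `Λ` of (3.3), `τ, τ′` of (3.7) | `TransferSetting` | structure (data only) |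
| §3.1 DEF. of a set of (G,H)-orbital-integral transfer factors, (3.1.1) (p. 393) | `IsMatching`, `IsTransferFactorFamily` | def |
| §3.1 the «discriminant» function `Δ⁰_(T,η)` (p. 394 display) | `discriminantFactor` | def (REAL) |
| §3.1 PROPOSITION 3.1.2 (p. 394) | `Shelstad1982_3_1_2_weylTransform` | def (Prop) |
| §3.1 «admissible», (3.1.3)–(3.1.4) (p. 394) | `IsUnitaryCharOn`, `IsAdmissibleVia`, `IsAdmissible` | def |
| §3.1 p. 394 «is well-defined and invariant under `𝔄(T′_{γ′})`» | `Shelstad1982_3_1_kernelWellDefined` | def (Prop) |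
| (3.3) p. 397 ∕ §4 p. 402 ∕ §5 p. 414: `Δ_(T,η) = (−1)^{q(G,H)} ε(T,η) Λ_(T,η) Δ⁰_(T,η)` | `shelstadDelta`, `IsXiFamily`, `FamilyEq` | def (REAL) |
| §3.5 data: framework `T′_0 … T′_N`, adjacency, «succeeds», `ε(m,n)` of [15], the (3.3)-family of a sign system | `SignFramework` | structure (data only) |
| §3.5 (3.5.1) and «necessary and sufficient» (pp. 398–399, [15, Thm. 10.2]) | `SatisfiesSignConditions`, `Shelstad1982_3_5_transferIffSignConditions` | def |
| §3.5 p. 399 «so does `{−ε}`, but there are no further possibilities» | `Shelstad1982_3_5_signSolutions` | def (Prop) |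
| §3.5 PROPOSITION 3.5.3 (p. 399) | `Shelstad1982_3_5_3_diamondProductIndependent` | def (Prop) |
| §3.5 THEOREM 3.5.4, (3.5.5) (p. 399) | `IsDiamond`, `Shelstad1982_3_5_4_diamondConsistency` | def |
| (3.6) Conclusions (p. 401) | `Shelstad1982_3_6_twoAttachedFamilies` | def (Prop) |
| (3.7) `q(G,H)` (pp. 401–402) | `qGH` | def (REAL) |
| §3.7 PROPOSITION 3.7.1 (p. 401) | `Shelstad1982_3_7_1_qIntegerQuasiSplit` | def (Prop) |
| §3.7 COROLLARY 3.7.2 (p. 402) | `Shelstad1982_3_7_2_qAdditive` | def (Prop) |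
| §4 p. 402: `Θ(f) = Θ′(f′)` | `IsLift` | def |
| §4 LEMMA 4.0.1 (p. 402) | `Shelstad1982_4_0_1_liftWellDefined` | def (Prop) |
| §4 data: L-packets `Π_φ`, `χ_π`, `Φ(G*) ⊇ Φ₀(G)`, `ξ^Φ`, `ε(π)`, `χ′ ↦ χ`, `𝔛`, orbits, `Θ(ωμ,λ,ωΨ)`, imaginary Weyl group, compact roots | `LiftingSetting` | structure (data only) |
| (4.1) «`φ` is relevant to `G`» (p. 402) | `IsRelevant` | def |
| §4 THEOREM 4.1.1 (p. 403) | `Shelstad1982_4_1_1_liftOfStableCharacter` | def (Prop) |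
| §4 COROLLARY 4.1.2 (p. 403) | `Shelstad1982_4_1_2_vanishingOffOriginating` | def (Prop) |
| §4 LEMMA 4.2.1 (p. 403) | `Shelstad1982_4_2_1_liftIsEigen` | def (Prop) |
| §4 PROPOSITION 4.2.3 (p. 403) | `Shelstad1982_4_2_3_liftVanishesOffOriginating` | def (Prop) |
| §4 LEMMA 4.3.1 (p. 405) | `Shelstad1982_4_3_1_equivalentIffSameOrbit` | def (Prop) |
| §4 THEOREM 4.3.2 = (4.3.3) + (4.3.4) (p. 406) | `Shelstad1982_4_3_2_packetCharacters` | def (Prop) |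
| §4 LEMMA 4.3.5 (p. 406), LEMMA 4.3.7 (p. 407) | `Shelstad1982_4_3_5_typeA1NotRelevant`, `Shelstad1982_4_3_7_typeA1Relevant` | def (Prop) |
| §4 DEFINITION 4.3.6 (p. 407) | `IsTotallyCompact` | def (REAL) |
| §4 p. 407 «a Cayley transform w.r.t. `α` exists iff `α` is not totally compact» | `Shelstad1982_4_3_cayleyIffNotTotallyCompact` | def (Prop) |
| (4.7) (4.7.1), (4.7.2)(b) (p. 414) | `Shelstad1982_4_7_characterIdentities` | def (Prop) |

NOT typed here (census): (3.1.5) (p. 395) and PROPOSITIONS 3.2.3–3.2.4, (3.3) correction characters (3.3.3), PROPOSITION 3.4.2,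
the signs `ε(m,n) = ε₊ε_κ` — the §2∕(3.2)–(3.4) set-up carpet `EndoscopicData.lean` (block B); they enter this file only as the
dictionary fields `TransferSetting.IsCoherent` («satisfies (3.1.5)»), `TransferSetting.LambdaXi` («the `Λ_(T,η)` attached to `ξ` by
(3.3.3)»), `SignFramework.epsAdjOf` ∕ `familyOf`.  LEMMA 4.2.4 and (4.7.2)(a) (the explicit kernel
`(−1)^{q(G,H)+n(T)} Σ_ν ε(T,η_ν) Σ_ω κ_ν(ω) Δ_ν^{H∕G}(γ^ω) F^{(ν)}(γ^ω)`, pp. 404, 414) — banked: they need the (4.2) carriers `Δ_ν^{H∕G}`,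
`Ω₀(G,T)∕Ω₀^{(κ_ν)}(G,T)`, no consumer cites them; §§4.4–4.6 (PROPOSITION 4.4.4 … COROLLARY 4.4.9, the definitions (4.4.3), (4.4.10),
(4.5.1) of `ε(π)`: proof internals of 4.1.1∕4.3.2 — here `ε(π)` is the dictionary field `LiftingSetting.eps` and Theorem 4.1.1 records
print's «each `ε(π)` is … `+1` or `−1`»); §5 (`𝕊_φ`, THEOREMS 5.4.4∕5.4.26∕5.4.27) — block C, no consumer.  Dedup: no
`Literature/…/Shelstad1982/` file before this one; `lean search 'TransferFactorFamily|shelstadDelta|IsTotallyCompact|liftOfStable' --decl` = 0;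
the ★ Rogawski1990 transfer dress (`TransferFactorData`, `IsDeltaTransferRel`: conjugacy-class sums for matrix groups) is a
different currency (explicit `U(3)` carriers) and is cited, not restated; the ★ `Shelstad1979.StableOrbitalIntegrals.innerFormSign q = (−1)^q`
is print's `(−1)^{q(G,G*)}` — here `(−1)^{q(G,H)}` is spelled `(-1 : ℂ) ^ D.qGH` inline.

## References
* [Shelstad1982] D. Shelstad, *L-indistinguishability for real groups*, Math. Ann. 259 (1982) 385–430: §3 pp. 393–402, §4 pp. 402–414
  (GDZ PPN235181684_0259, LOG_0060; page images `T/LNS/TN-t05/g4/pages-Shelstad1982/`).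
* [Shelstad1979] D. Shelstad, *Characters and inner forms of a quasi-split group over ℝ*, Compositio Math. 39 (1979) 11–45 (= print's
  [14]; the dictionary `TemperedSetting`).
-/

universe u

namespace Literature.NumberTheory.Automorphic.Shelstad1982.TransferAndLifting

/-! ## §3.1 — the dictionary `TransferSetting G H` -/

/-- **The data of §3 for the pair `(G, H)`** (data only; no field asserts a proposition).  `G` is (the group of real points of) a
connected reductive group over `ℝ`, `H` an endoscopic group for `G` with `𝔰_H = (s_H, ᴸH)` fixed as in (2.2) and `ᴸH` in standard
position, `ξ = ξ(μ*, λ*) : ᴸH ↪ ᴸG` a fixed admissible embedding of unitary type (pp. 393, 397, 402).  Fields: `SG`, `SH` = the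
Harish-Chandra data of `G` and of `H` (★ `Shelstad1979.Correspondences.TemperedSetting`: `G_reg`, `𝒞(G)`, tempered dual, `χ_φ`, `F_Θ`,
`2q_G`; here `SH.stOrb γ′` is print's `f′ ↦ Φ^{(T′,1)}_{f′}(γ′, dt′, dh)`, the stable orbital integral at `γ′ ∈ T′ ∩ H_reg` with the measures
of p. 394); `Pair` = the set `𝒯_H(G)` of pairs `(T, η)` (p. 392; `T` a Cartan subgroup of `G`, `η` a p.d. of `𝐓`, with attached
quasicharacter `κ`, p. 393 «Notation»); `torus p` = `T` (real points, a subgroup of `G`); `kappaOrb p γ` = `f ↦ Φ^{(T,κ)}_f(γ, dt, dg)`,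
the `κ`-orbital integral of [15] (p. 394: «`dt` is arbitrary … `Φ^{(T,κ)}_f( , , )` … as in [15]»; values off `T ∩ G_reg` never used);
`CartanG`, `CartanH` = the Cartan subgroups of `G`, `H`; `cartanOfG γ` = `T_γ` for `γ ∈ G_reg`, `cartanOfH γ′` = `T′_{γ′}`, «the Cartan
subgroup of `H` containing `γ′`» (p. 394); `pairCartan p` = the `T` of `(T, η)`; `cartanOrig T′ T` = «`T′` originates from `T`» (p. 393:
«`𝐓′` is the preimage of `𝐓` under some `i(h, η)`»); `originatesVia p γ′ γ` = «`γ′ ∈ H` originates from `γ ∈ G_reg` via `(T, η)`» (p. 393: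
«`γ′` is the preimage of `γ` under some such map `i(h,η) : 𝐓′ → 𝐓`»); `Root`, `roots p` = `Δ(𝐆, 𝐓)`, `rootVal p α γ` = `α(γ) ∈ ℂ`,
`IsPos p α` = «`α > 0` … positive with respect to the order determined by `η` and the Borel subgroup `𝐁*` of `𝐆*`» (p. 394),
`IsImag p α` = «`σα = −α`» (`σ = σ_T` the Galois action), `kappaCoroot p α` = `κ(α^∨)` (p. 394); `Weyl0k p` = `Ω₀(𝐆,𝐓) ∩ Ω^{(κ)}(𝐆,𝐓)`
(p. 394; `Ω₀ = {ω : ωσ = σω}`, `Ω^{(κ)}` from Prop. 2.3.1), `weylAct p ω γ` = `γ^ω`, `kappaW p ω` = `κ(ω)` (p. 394), `iotaDiff p ω γ` =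
`(ι_* − ω⁻¹ι_*)(γ)` where `ι_* = ½ Σ_{α>0, σα=−α, κ(α^∨)≠1} α` («Note that `ι_* − ω⁻¹ι_* ∈ X*(𝐓)`, so that `(ι_* − ω⁻¹ι_*)(γ)` is
well-defined», p. 394); `stabH γ′ γ″` = «`γ″ = (γ′)^{ω′}`, `ω′ ∈ 𝔄_H(T′)`» (p. 393 Prop. 2.4.5 (ii), p. 394); `IsCoherent Δ` = «the
family `{Δ_(T,η)}` satisfies the compatibility conditions (3.1.5)» (p. 395; spelled out in the companion carpet `EndoscopicData`);
`LambdaXi p` = `Λ_(T,η)`, the character on `T` attached to `ξ` by (3.3.3) (`Λ^G_n = χ^G(μ* + ι_n − ι′_n, λ*)` on the framework, p. 397)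
and (3.1.5); `tau`, `tau'` = `τ`, `τ′`, «the dimension of the maximal compact subgroups of `M_T`», resp. `M_{T′}`, for the fundamental
Cartan subgroup `T′` of `H` originating from `T` in `G` (p. 401); `fundOrig` = «the fundamental Cartan subgroups of `H` originate in
`G`» (p. 401); `qGGstar`, `qGstarH` = the numbers `q(G, G*)`, `q(G*, H)` of the pairs `(G, G*)`, `(G*, H)` (p. 402: «both numbers on the
right-hand side … being well-defined»); `IsQuasiSplitForm` = «`H = G*`» (p. 401); `tauG`, `tauH` = `τ_G`, `τ_H`, «the dimension of the
maximal compact subgroups of `G`», `H` (p. 401). [cite: Shelstad1982, §3.1 pp. 393–395; §3.3 p. 397; §3.7 pp. 401–402; §2.4 pp. 392–393] -/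
structure TransferSetting (G H : Type u) [Group G] [Group H] where
  /-- Harish-Chandra data of `G` (★ `TemperedSetting`). -/
  SG : Shelstad1979.Correspondences.TemperedSetting G
  /-- Harish-Chandra data of `H`; `SH.stOrb γ′ = (f′ ↦ Φ^{(T′,1)}_{f′}(γ′, dt′, dh))` (p. 394). -/
  SH : Shelstad1979.Correspondences.TemperedSetting H
  /-- `𝒯_H(G)`, the pairs `(T, η)` (p. 392). -/
  Pair : Type u
  /-- `T` (real points) of the pair `(T, η)`. -/
  torus : Pair → Subgroup G
  /-- `γ ↦ (f ↦ Φ^{(T,κ)}_f(γ, dt, dg))`, the `κ`-orbital integrals of [15] (p. 394). -/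
  kappaOrb : Pair → G → Module.Dual ℂ SG.schwartz
  /-- The Cartan subgroups of `G`. -/
  CartanG : Type u
  /-- The Cartan subgroups of `H`. -/
  CartanH : Type u
  /-- `T_γ`, the Cartan subgroup of `G` containing `γ ∈ G_reg` (junk off `G_reg`). -/
  cartanOfG : G → CartanG
  /-- `T′_{γ′}`, the Cartan subgroup of `H` containing `γ′ ∈ H_reg` (p. 394). -/
  cartanOfH : H → CartanH
  /-- The `T` of `(T, η)`. -/
  pairCartan : Pair → CartanG
  /-- «`T′` originates from `T`» (p. 393). -/
  cartanOrig : CartanH → CartanG → Prop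
  /-- «`γ′ ∈ H` originates from `γ ∈ G_reg` via `(T, η)`» (p. 393). -/
  originatesVia : Pair → H → G → Prop
  /-- The roots (of all `(𝐆, 𝐓)`). -/
  Root : Type u
  /-- `Δ(𝐆, 𝐓)` for the `T` of `(T, η)`. -/
  roots : Pair → Finset Root
  /-- `α(γ)` for `γ ∈ T` (p. 394). -/
  rootVal : Pair → Root → G → ℂ
  /-- «`α > 0`» w.r.t. the order determined by `η` and `𝐁*` (p. 394). -/
  IsPos : Pair → Root → Prop
  /-- «`σα = −α`» (p. 394). -/
  IsImag : Pair → Root → Prop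
  /-- `κ(α^∨)` (p. 394). -/
  kappaCoroot : Pair → Root → ℂ
  /-- `Ω₀(𝐆,𝐓) ∩ Ω^{(κ)}(𝐆,𝐓)` (p. 394). -/
  Weyl0k : Pair → Type u
  /-- `γ ↦ γ^ω` (p. 394). -/
  weylAct : (p : Pair) → Weyl0k p → G → G
  /-- `κ(ω)` (Prop. 3.1.2, p. 394). -/
  kappaW : (p : Pair) → Weyl0k p → ℂ
  /-- `(ι_* − ω⁻¹ι_*)(γ)` (p. 394). -/
  iotaDiff : (p : Pair) → Weyl0k p → G → ℂ
  /-- `γ″ = (γ′)^{ω′}` for some `ω′ ∈ 𝔄_H(T′_{γ′})` (pp. 393–394). -/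
  stabH : H → H → Prop
  /-- «`{Δ_(T,η)}` satisfies (3.1.5)» (p. 395). -/
  IsCoherent : (Pair → G → ℂ) → Prop
  /-- `Λ_(T,η)` attached to `ξ` by (3.3.3) and (3.1.5) (p. 397). -/
  LambdaXi : Pair → G → ℂ
  /-- `τ` (p. 401). -/
  tau : ℕ
  /-- `τ′` (p. 401). -/
  tau' : ℕ
  /-- «the fundamental Cartan subgroups of `H` originate in `G`» (p. 401). -/
  fundOrig : Prop
  /-- `q(G, G*)` (p. 402). -/
  qGGstar : ℤ
  /-- `q(G*, H)` (p. 402). -/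
  qGstarH : ℤ
  /-- «`H = G*`» (p. 401). -/
  IsQuasiSplitForm : Prop
  /-- `τ_G` (p. 401). -/
  tauG : ℕ
  /-- `τ_H` (p. 401). -/
  tauH : ℕ

/-- **A (unitary) character on the subgroup `T`**, for a function `Λ : G → ℂ` only ever evaluated on `T`: multiplicative on `T`,
`Λ(1) = 1`, `|Λ(t)| = 1` (p. 394 «`Λ_(T,η)` is a character on `T`»; p. 397 «of unitary type … is a character (that is, is unitary)»).
[cite: Shelstad1982, §3.1 p. 394; §3.3 p. 397] -/
def IsUnitaryCharOn {G : Type u} [Group G] (T : Subgroup G) (Λ : G → ℂ) : Prop :=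
  Λ 1 = 1 ∧ (∀ s ∈ T, ∀ t ∈ T, Λ (s * t) = Λ s * Λ t) ∧ ∀ t ∈ T, ‖Λ t‖ = 1

namespace TransferSetting

variable {G H : Type u} [Group G] [Group H] (D : TransferSetting G H)

/-- **The matching (3.1.1) of one pair `(f, f′)`** for a family `{Δ_(T,η)}` of functions on the `T ∩ G_reg` (p. 393):
«`Φ^{(T′,1)}_{f′}(γ′, dt′, dh) = Δ_(T,η)(γ) Φ^{(T,κ)}_f(γ, dt, dg)` if `γ′` originates from `γ ∈ G_reg` via `(T, η)`; `= 0` if `T′` does not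
originate in `G`» (second clause for `γ′ ∈ T′ ∩ H_reg`, `T′ = T′_{γ′}`; «`T′` originates in `G`» = from some Cartan subgroup `T` of `G`,
p. 393). [cite: Shelstad1982, §3.1 (3.1.1) p. 393; §2.4 p. 393] -/
def IsMatching (Δ : D.Pair → G → ℂ) (f : D.SG.schwartz) (f' : D.SH.schwartz) : Prop :=
  (∀ (p : D.Pair) (γ' : H) (γ : G), γ ∈ D.torus p → γ ∈ D.SG.reg → D.originatesVia p γ' γ →
      D.SH.stOrb γ' f' = Δ p γ * D.kappaOrb p γ f) ∧
    ∀ γ' ∈ D.SH.reg, (∀ T : D.CartanG, ¬ D.cartanOrig (D.cartanOfH γ') T) → D.SH.stOrb γ' f' = 0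

/-- **DEFINITION (p. 393): a set of (G,H)-orbital-integral transfer factors.**  «Suppose that for each `(T, η) ∈ 𝒯_H(G)` we are given a
function `Δ_(T,η)` on `T ∩ G_reg`.  Then we call the family `{Δ_(T,η)}` of these functions *a set of (G,H)-orbital-integral transfer factors*
(or, more briefly, "transfer factors") if for each `f ∈ 𝒞(G)` there exists `f′ ∈ 𝒞(H)` such that (3.1.1).»  This is the «Schwartz
`f ↦ f^H`» transfer the consumers cite. [cite: Shelstad1982, §3.1 (3.1.1) p. 393] -/
def IsTransferFactorFamily (Δ : D.Pair → G → ℂ) : Prop :=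
  ∀ f : D.SG.schwartz, ∃ f' : D.SH.schwartz, D.IsMatching Δ f f'

/-- **The «discriminant» function `Δ⁰_(T,η)` on `T`** (p. 394 display; p. 402 «`Δ⁰_(T,η)` is the "discriminant" function of (3.1)»):
`Δ⁰_(T,η)(γ) = ∏_{α>0, σα=−α, κ(α^∨)≠1} (1 − α(γ⁻¹)) · ∏_{α>0, σα≠−α, κ(α^∨)≠1} |α(γ)^{1/2} − α(γ)^{−1/2}|`, where
«`|α(γ)^{1/2} − α(γ)^{−1/2}|` is to be interpreted as `|1 − α(γ)|^{1/2} |1 − α(γ⁻¹)|^{1/2}`». [cite: Shelstad1982, §3.1 p. 394] -/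
noncomputable def discriminantFactor (p : D.Pair) (γ : G) : ℂ :=
  (∏ α ∈ @Finset.filter D.Root (fun α => D.IsPos p α ∧ D.IsImag p α ∧ D.kappaCoroot p α ≠ 1)
        (Classical.decPred _) (D.roots p),
      (1 - D.rootVal p α γ⁻¹)) *
    ((∏ α ∈ @Finset.filter D.Root (fun α => D.IsPos p α ∧ ¬ D.IsImag p α ∧ D.kappaCoroot p α ≠ 1)
          (Classical.decPred _) (D.roots p),
        Real.sqrt ‖1 - D.rootVal p α γ‖ * Real.sqrt ‖1 - D.rootVal p α γ⁻¹‖ : ℝ) : ℂ)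

/-- **PROPOSITION 3.1.2 (p. 394).**  «Let `ω ∈ Ω₀(𝐆,𝐓) ∩ Ω^{(κ)}(𝐆,𝐓)`.  Then (i) `Φ^{(T,κ)}_f(γ^ω, dt, dg) = κ(ω) Φ^{(T,κ)}_f(γ, dt, dg)`, and
(ii) `Δ⁰_(T,η)(γ^ω) = κ(ω) (ι_* − ω⁻¹ι_*)(γ) Δ⁰_(T,η)(γ)`, where `ι_* = ½ Σ_{α>0, σα=−α, κ(α^∨)≠1} α`» (for `γ ∈ T ∩ G_reg`, `f ∈ 𝒞(G)`).
[cite: Shelstad1982, Prop. 3.1.2 (p. 394)] -/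
def Shelstad1982_3_1_2_weylTransform : Prop :=
  ∀ (p : D.Pair) (ω : D.Weyl0k p), ∀ γ ∈ D.torus p, γ ∈ D.SG.reg →
    (∀ f : D.SG.schwartz, D.kappaOrb p (D.weylAct p ω γ) f = D.kappaW p ω * D.kappaOrb p γ f) ∧
      D.discriminantFactor p (D.weylAct p ω γ) = D.kappaW p ω * D.iotaDiff p ω γ * D.discriminantFactor p γ

/-- **«Of the form (3.1.3)» with explicit sign and character data** (p. 394): `ε(T,η) = ±1`, `Λ_(T,η)` a character on `T` satisfying
(3.1.4) «`Λ_(T,η)(γ^ω) = (ω⁻¹ι_* − ι_*)(γ) Λ_(T,η)(γ)`, `ω ∈ Ω₀(𝐆,𝐓) ∩ Ω^{(κ)}(𝐆,𝐓)`» (the character `ω⁻¹ι_* − ι_*` is the inverse of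
`ι_* − ω⁻¹ι_*`, whose value is the field `iotaDiff`), and (3.1.3) «`Δ_(T,η) = (−1)^{q(G,H)} ε(T,η) Λ_(T,η) Δ⁰_(T,η)`» on `T ∩ G_reg`, with
`q(G,H)` the integer of (3.7) («inserted only for convenience»).  The sign system is valued in `ℤˣ = {±1}`. [cite: Shelstad1982, §3.1 (3.1.3)–(3.1.4) p. 394] -/
def IsAdmissibleVia (q : ℤ) (Δ : D.Pair → G → ℂ) (ε : D.Pair → ℤˣ) (Λ : D.Pair → G → ℂ) : Prop :=
  (∀ p : D.Pair, IsUnitaryCharOn (D.torus p) (Λ p)) ∧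
    (∀ (p : D.Pair) (ω : D.Weyl0k p), ∀ γ ∈ D.torus p,
        Λ p (D.weylAct p ω γ) = (D.iotaDiff p ω γ)⁻¹ * Λ p γ) ∧
      ∀ (p : D.Pair), ∀ γ ∈ D.torus p, γ ∈ D.SG.reg →
        Δ p γ = (-1 : ℂ) ^ q * ((ε p : ℤ) : ℂ) * Λ p γ * D.discriminantFactor p γ

/-- **`q(G, H)` (3.7) (pp. 401–402).**  «We begin with the assumption that the fundamental Cartan subgroups of `H` originate in `G` …
Suppose that the fundamental Cartan subgroup `T′` of `H` originates from `T` in `G`.  Let `τ′` be the dimension of the maximal compact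
subgroups of `M_{T′}`, and `τ` be the dimension of the maximal compact subgroups of `M_T`.  Then we set `q(G,H) = ½(τ − τ′)`.  Clearly
`q(G,H)` does not depend on the choice of `T′` and `T`.» … (p. 402) «If the fundamental Cartan subgroups of `H` do not originate in `G` we
set `q(G,H) = q(G,G*) + q(G*,H)`, both numbers on the right-hand side of this equation being well-defined.»  (Integer division by
`2` is exact in print's case by Prop. 3.7.1 (i).) [cite: Shelstad1982, §3.7 pp. 401–402] -/
noncomputable def qGH : ℤ :=
  @ite ℤ D.fundOrig (Classical.dec _) (((D.tau : ℤ) - (D.tau' : ℤ)) / 2) (D.qGGstar + D.qGstarH)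

/-- **Admissible family** (p. 394): «We will call a family `{Δ_(T,η)}` of (G,H)-orbital-integral transfer factors *admissible* if each
`Δ_(T,η)` is of the form (3.1.3) … where … `ε(T,η) = ±1`, and `Λ_(T,η)` is a character on `T` satisfying (3.1.4).»
[cite: Shelstad1982, §3.1 (3.1.3)–(3.1.4) p. 394] -/
def IsAdmissible (Δ : D.Pair → G → ℂ) : Prop :=
  D.IsTransferFactorFamily Δ ∧ ∃ (ε : D.Pair → ℤˣ) (Λ : D.Pair → G → ℂ), D.IsAdmissibleVia D.qGH Δ ε Λ

/-- **p. 394, the kernel is well defined.**  «If `{Λ_(T,η)}` is any family of characters satisfying (3.1.4) and `{ε(T,η)}` any choice of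
signs, then the family `{Δ_(T,η)}` defined by (3.1.3) has the property that `γ′ ↦ Δ_(T,η)(γ) Φ^{(T,κ)}_f(γ, dt, dg)`, for `γ′` originating
from `γ ∈ G_reg` via `(T, η)`, is well-defined and invariant under `𝔄(T′_{γ′})`, where `T′_{γ′}` is the Cartan subgroup of `H` containing
`γ′` (cf. Propositions 2.4.5 and 3.1.2).  This function depends, however, on the choice of `(T, η)`.»  TYPED: for such a family and a
FIXED `(T, η)`, the value does not depend on the `γ ∈ T ∩ G_reg` from which `γ′` originates via `(T, η)` (these are the `γ^ω`,
`ω ∈ Ω₀(𝐆,𝐓) ∩ Ω^{(κ)}(𝐆,𝐓)`, Prop. 2.4.5 (iii)), and it agrees at `γ′` and at `(γ′)^{ω′}`, `ω′ ∈ 𝔄_H(T′_{γ′})` (the dependence on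
`(T, η)` is governed by (3.1.5), block B). [cite: Shelstad1982, §3.1 p. 394] -/
def Shelstad1982_3_1_kernelWellDefined : Prop :=
  ∀ (Δ : D.Pair → G → ℂ) (ε : D.Pair → ℤˣ) (Λ : D.Pair → G → ℂ), D.IsAdmissibleVia D.qGH Δ ε Λ →
    ∀ (f : D.SG.schwartz) (p : D.Pair) (γ' γ'' : H) (γ₁ γ₂ : G),
      γ₁ ∈ D.torus p → γ₂ ∈ D.torus p → γ₁ ∈ D.SG.reg → γ₂ ∈ D.SG.reg →
        D.originatesVia p γ' γ₁ → (γ'' = γ' ∨ D.stabH γ' γ'') → D.originatesVia p γ'' γ₂ →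
          Δ p γ₁ * D.kappaOrb p γ₁ f = Δ p γ₂ * D.kappaOrb p γ₂ f

/-- **Shelstad's real transfer factor `Δ_(T,η)` — the NAMED object `Δ^{(ℝ)}`** ((3.3) p. 397: «`Δ^G_n = (−1)^{q(G,H)} ε^G_n Λ^G_n Δ⁰^G_n` and
define `{Δ_(T,η)}` by setting `Δ_(T^G_n, η^G_n) = Δ^G_n` and requiring that (3.1.5) be satisfied»; §4 p. 402 «we write `Δ_(T,η)` as
`(−1)^{q(G,H)} ε(T,η) Λ_(T,η) Δ⁰_(T,η)` where `ε(T,η) = ±1`, `Λ_(T,η)` is a character on `T` and `Δ⁰_(T,η)` is the "discriminant" function of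
(3.1)»; §5 p. 414 display): for a sign system `ε : 𝒯_H(G) → {±1}`, the family
`(T,η), γ ↦ (−1)^{q(G,H)} ε(T,η) Λ_(T,η)(γ) Δ⁰_(T,η)(γ)` built from the dictionary's correction characters `Λ_(T,η)` attached to `ξ`
and the DEFINED `q(G,H)`, `Δ⁰_(T,η)`.  This is the `ΔR` of ★ `LanglandsShelstad1990Descent_2_6_A_archimedeanTransferFactor` («`Δ = c Δ_(ℝ)`»,
[LS1990, Thm. 2.6.A]) once a consumer identifies its matching pairs with `(γ′, γ)` originating via `(T, η)`. [cite: Shelstad1982, §3.3 p. 397; §4 p. 402; §5 p. 414] -/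
noncomputable def shelstadDelta (ε : D.Pair → ℤˣ) (p : D.Pair) (γ : G) : ℂ :=
  (-1 : ℂ) ^ D.qGH * ((ε p : ℤ) : ℂ) * D.LambdaXi p γ * D.discriminantFactor p γ

/-- **Equality of two families on the `T ∩ G_reg`** (where alone print's `Δ_(T,η)` live, p. 393). [cite: Shelstad1982, §3.1 p. 393] -/
def FamilyEq (Δ Δ' : D.Pair → G → ℂ) : Prop :=
  ∀ (p : D.Pair), ∀ γ ∈ D.torus p, γ ∈ D.SG.reg → Δ p γ = Δ' p γ

/-- **A family attached to `ξ`** ((3.3) p. 397, (3.6) p. 401): of the form `shelstadDelta ε` on the `T ∩ G_reg` for some sign system `ε`,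
and satisfying the compatibilities (3.1.5). [cite: Shelstad1982, §3.3 p. 397; §3.6 p. 401] -/
def IsXiFamily (Δ : D.Pair → G → ℂ) : Prop :=
  D.IsCoherent Δ ∧ ∃ ε : D.Pair → ℤˣ, D.FamilyEq Δ (D.shelstadDelta ε)

/-- **(3.6) CONCLUSIONS (p. 401) — existence of the transfer.**  «We have now attached to each admissible embedding `ξ : ᴸH ↪ ᴸG` of
unitary type, two admissible families of (G,H)-orbital-integral-transfer factors.  If `{Δ_(T,η)}` is one family, then `{−Δ_(T,η)}` is the
other.»  TYPED: some family attached to `ξ` IS a set of transfer factors (every `f ∈ 𝒞(G)` has an `f′ ∈ 𝒞(H)` with (3.1.1)), and for any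
such `Δ` the attached families that are sets of transfer factors are exactly `Δ` and `−Δ` (on the `T ∩ G_reg`).  This is the statement
the tree cites as «Shelstad's real endoscopic (Schwartz) transfer». [cite: Shelstad1982, §3.6 p. 401; §3.1 (3.1.1) p. 393] -/
def Shelstad1982_3_6_twoAttachedFamilies : Prop :=
  (∃ Δ : D.Pair → G → ℂ, D.IsXiFamily Δ ∧ D.IsTransferFactorFamily Δ) ∧
    ∀ Δ : D.Pair → G → ℂ, D.IsXiFamily Δ → D.IsTransferFactorFamily Δ →
      ∀ Δ' : D.Pair → G → ℂ, D.IsXiFamily Δ' →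
        (D.IsTransferFactorFamily Δ' ↔ D.FamilyEq Δ' Δ ∨ D.FamilyEq Δ' (fun p γ => -Δ p γ))

/-- **PROPOSITION 3.7.1 (p. 401).**  «(i) `q(G,H)` is an integer» — under the standing assumption of (3.7) that the fundamental Cartan
subgroups of `H` originate in `G`, `½(τ − τ′) ∈ ℤ`, i.e. `τ − τ′` is even; «(ii) If `H = G*` then `q(G,H) = ½(τ_G − τ_H) = q_G − q_H`, where
`τ_G` is the dimension of the maximal compact subgroups of `G` and `2q_G` is the dimension of the symmetric space attached to `G_sc`»
(`2q_G`, `2q_H` are the `twoq` fields of the two ★ `TemperedSetting`s; for `H = G*` the fundamental Cartan subgroup of `H` originates in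
`G`). [cite: Shelstad1982, Prop. 3.7.1 (p. 401)] -/
def Shelstad1982_3_7_1_qIntegerQuasiSplit : Prop :=
  (D.fundOrig → (2 : ℤ) ∣ ((D.tau : ℤ) - (D.tau' : ℤ))) ∧
    (D.IsQuasiSplitForm → D.fundOrig ∧
      2 * D.qGH = (D.tauG : ℤ) - (D.tauH : ℤ) ∧ 2 * D.qGH = (D.SG.twoq : ℤ) - (D.SH.twoq : ℤ))

/-- **COROLLARY 3.7.2 (p. 402).**  «`q(G,H) = q(G,G*) + q(G*,H)`» (under the standing assumption of (3.7); when the fundamental Cartan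
subgroups of `H` do not originate in `G` this identity is the DEFINITION of `q(G,H)`, p. 402, cf. `qGH`). [cite: Shelstad1982, Cor. 3.7.2 (p. 402)] -/
def Shelstad1982_3_7_2_qAdditive : Prop :=
  D.fundOrig → D.qGH = D.qGGstar + D.qGstarH

end TransferSetting

/-! ## §3.5 — choice of signs: the dictionary `SignFramework D` -/

/-- **The framework data of (3.2)–(3.5)** (data only).  Print fixes a «framework of Cartan subgroups»: standard Cartan subgroups
`T′_0, …, T′_N = T_H` of `H` representing all conjugacy classes (p. 395), the pairs `(T^G_n, η^G_n) ∈ 𝒯_H(G)` for the `T′_n` originating in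
`G` (pp. 395–396), and, from [15], for ADJACENT `T′_m, T′_n` «a sign `ε(m, n) = ε₊(m, n) ε_κ(m, n)`» attached to
`(T′_m, T′_n, i^G_m, i^G_n, I⁺_m, I⁺_n)` (p. 398).  Fields: `Idx` = the indices `n` with `T′_n` originating in `G`; `pairOf n` = `(T^G_n, η^G_n)`;
`Adj m n` = «`T′_m` and `T′_n` are adjacent» (p. 398, [15]); `Succ m n` = «`T′_n` succeeds `T′_m` (in the sense of [15])» (p. 399);
`Choice` = the auxiliary choices of p. 399 («`T^G_m, T^G_n, T^G_p` within respective conjugacy classes, `α_i`, `s_i`, `β_i`, `t_i` … and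
the images `i^G_m, i^G_{n₁}, i^G_{n₂}, i^G_p`»), `chosen` = the choice fixed with the framework, `epsAdjOf c m n` = `ε(m, n)` computed with
the choices `c` (print's `ε(m, n)` = `epsAdjOf chosen m n`); `familyOf ε` = the family `{Δ_(T,η)}` «defined in (3.3)» from the sign system `{ε^G_n}` (p. 397: `Δ^G_n =
(−1)^{q(G,H)} ε^G_n Λ^G_n Δ⁰^G_n`, `Δ_(T^G_n, η^G_n) = Δ^G_n`, extended by (3.1.5)). [cite: Shelstad1982, §3.2 pp. 395–396; §3.3 p. 397; §3.5 pp. 398–399] -/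
structure SignFramework {G H : Type u} [Group G] [Group H] (D : TransferSetting G H) where
  /-- The framework indices `n` with `T′_n` originating in `G`. -/
  Idx : Type u
  /-- `n ↦ (T^G_n, η^G_n)` (p. 396). -/
  pairOf : Idx → D.Pair
  /-- Adjacency of `T′_m, T′_n` (p. 398). -/
  Adj : Idx → Idx → Prop
  /-- «`T′_n` succeeds `T′_m`» (p. 399). -/
  Succ : Idx → Idx → Prop
  /-- The auxiliary choices of p. 399. -/
  Choice : Type u
  /-- The choices fixed with the framework. -/
  chosen : Choice
  /-- `ε(m, n)` of [15] computed with the choices `c` (pp. 398–399). -/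
  epsAdjOf : Choice → Idx → Idx → ℤˣ
  /-- The (3.3)-family of a framework sign system (p. 397). -/
  familyOf : (Idx → ℤˣ) → D.Pair → G → ℂ

namespace SignFramework

variable {G H : Type u} [Group G] [Group H] {D : TransferSetting G H} (F : SignFramework D)

/-- **(3.5.1)** (p. 398): «`ε^G_m ε^G_n = ε(m, n)` for each adjacent pair `(T′_m, T′_n)`». [cite: Shelstad1982, §3.5 (3.5.1) pp. 398–399] -/
def SatisfiesSignConditions (ε : F.Idx → ℤˣ) : Prop :=
  ∀ m n : F.Idx, F.Adj m n → ε m * ε n = F.epsAdjOf F.chosen m n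

/-- **(3.5), necessity and sufficiency (pp. 398–399).**  «In order that `{Δ_(T,η)}` be a family of (G,H)-orbital-integral-transfer
factors it is necessary and sufficient that (3.5.1) `ε^G_m ε^G_n = ε(m, n)` for each adjacent pair `(T′_m, T′_n)` (cf. Theorem 10.2 of
[15])» — for the family defined in (3.3) from `{ε^G_n}`. [cite: Shelstad1982, §3.5 pp. 398–399; §3.3 p. 397] -/
def Shelstad1982_3_5_transferIffSignConditions : Prop :=
  ∀ ε : F.Idx → ℤˣ, D.IsTransferFactorFamily (F.familyOf ε) ↔ F.SatisfiesSignConditions ε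

/-- **p. 399, the two solutions.**  «If `{ε^G_n}` satisfies these conditions then so does `{−ε^G_n}`, but there are no further
possibilities.» [cite: Shelstad1982, §3.5 p. 399] -/
def Shelstad1982_3_5_signSolutions : Prop :=
  ∀ ε : F.Idx → ℤˣ, F.SatisfiesSignConditions ε →
    F.SatisfiesSignConditions (fun n => -ε n) ∧
      ∀ ε' : F.Idx → ℤˣ, F.SatisfiesSignConditions ε' → (ε' = ε ∨ ε' = fun n => -ε n)

/-- **A diamond `(T′_m, T′_{n₁}, T′_{n₂}, T′_p)`** (p. 399): «both `T′_{n₁}`, `T′_{n₂}` succeed `T′_m`, in `H`, and … `T′_p` succeeds both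
`T′_{n₁}` and `T′_{n₂}`». [cite: Shelstad1982, §3.5 p. 399] -/
def IsDiamond (m n₁ n₂ p : F.Idx) : Prop :=
  F.Succ m n₁ ∧ F.Succ m n₂ ∧ F.Succ n₁ p ∧ F.Succ n₂ p

/-- **PROPOSITION 3.5.3 (p. 399).**  «`ε(m, n₁) ε(n₁, p) ε(m, n₂) ε(n₂, p)` does not depend on the choices for `i^G_m, i^G_{n₁}, i^G_{n₂},
i^G_p`» (for a diamond; p. 399 also: «We may change our choices for `T^G_m, T^G_n, T^G_p` …, `α_i, s_i, β_i` and `t_i` without changing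
`ε(m, n)`, `ε(n, p)` [15, Sect. 10]»). [cite: Shelstad1982, Prop. 3.5.3 (p. 399)] -/
def Shelstad1982_3_5_3_diamondProductIndependent : Prop :=
  ∀ m n₁ n₂ p : F.Idx, F.IsDiamond m n₁ n₂ p → ∀ c c' : F.Choice,
    F.epsAdjOf c m n₁ * F.epsAdjOf c n₁ p * F.epsAdjOf c m n₂ * F.epsAdjOf c n₂ p =
      F.epsAdjOf c' m n₁ * F.epsAdjOf c' n₁ p * F.epsAdjOf c' m n₂ * F.epsAdjOf c' n₂ p

/-- **THEOREM 3.5.4 (p. 399)** — the question left open in [15, Sect. 11].  «For all `(T′_m, T′_{n₁}, T′_{n₂}, T′_p)` we have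
(3.5.5) `ε(m, n₁) ε(n₁, p) = ε(m, n₂) ε(n₂, p)`» (all diamonds; p. 399: «it is sufficient that we verify (3.5.2) for all "diamonds"»).
[cite: Shelstad1982, Thm. 3.5.4 (p. 399)] -/
def Shelstad1982_3_5_4_diamondConsistency : Prop :=
  ∀ m n₁ n₂ p : F.Idx, F.IsDiamond m n₁ n₂ p →
    F.epsAdjOf F.chosen m n₁ * F.epsAdjOf F.chosen n₁ p = F.epsAdjOf F.chosen m n₂ * F.epsAdjOf F.chosen n₂ p

end SignFramework

/-! ## §4 — lifting characters: the dictionary `LiftingSetting G H` -/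

/-- **The data of §4** (data only), over the §3 data.  Fields: `toTransferSetting`; `Delta` = «`{Δ_(T,η)}` … one of the two admissible
families of (G,H)-orbital-integral-transfer factors attached to `ξ`» fixed throughout §4 (p. 402); `Rep` = (infinitesimal equivalence
classes of) irreducible tempered admissible representations of `G`, `charOf π` = `χ_π` as a tempered distribution; `packet φ` = `Π_φ`, the
L-packet of the tempered parameter `φ ∈ Φ₀(G)` (= `SG.Param`; finite: «the cardinality of `Π_φ` is bounded by the order of `𝕊_φ`», p. 386);
`ParamStar` = `Φ(G*)`, the equivalence classes of admissible homomorphisms `φ : W → ᴸG` (p. 405); `IsTempered ψ` = «`φ(W)` is bounded»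
(`Φ₀(G*)`), `RelevantStar ψ` = «relevant to `G`»: «`φ(W)` lies only in parabolic subgroups of `ᴸG` relevant to `G`» (`Φ(G)`, p. 405);
`toStar` = the inclusion `Φ₀(G) ⊂ Φ₀(G*)` (p. 402); `xiParam` = `ξ^Φ : Φ₀(H) → Φ₀(G*)`, «induced by our fixed embedding `ξ`» (p. 402,
landing in `Φ₀(G*)`); `eps φ′ π` = `ε(π)`, «either `+1` or `−1`, as defined below [cf. (4.4.3), (4.4.10), and (4.5.1)]» (p. 403);
`infCharLift` = `χ′ ↦ χ`, the character of `𝔷` defined by `χ(z) = χ′(z′)` from `z ↦ z′ : 𝔷 → 𝔷′` (p. 403); `XData` = `𝔛`, the pairs `(μ, λ̲)`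
of p. 405, `IsX0 x` = «`Re μ = 0`» (`𝔛₀`), `orbitRel` = «belong to the same orbit» of `Ω(ᴸG⁰, ᴸT⁰)` (p. 405), `phiX x` = the class of
`φ(μ, λ)` in `Φ(G*)` (p. 405); `WeylGT` = `Ω(𝐆, 𝐓)` for the fixed `T` compact modulo the center and p.d. `η` (p. 406), `PosSys` = positive
systems `Ψ` for `Δ(ᴸG⁰, ᴸT⁰)`, `IsDominant x Ψ` = «`μ` is dominant» w.r.t. `Ψ`, `Theta x Ψ ω` = the distribution `Θ(ωμ, λ, ωΨ)` (p. 406: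
a discrete-series character for a regular orbit, defined by coherent continuation for a singular one); `IsTypeA1 x` = «`Δ^∨_μ =
{α^∨ ∈ Δ(ᴸG⁰,ᴸT⁰) : ⟨μ, α^∨⟩ = 0}` is of type `A₁ × … × A₁`» (p. 406); `ImWeyl p` = the imaginary Weyl group of `(𝐆, 𝐓)` («equivalently
`𝔄(T)`», Def. 4.3.6), `imWeylSmul` its action on roots, `IsCompactRoot p α` = «`α` is compact», `HasCayley p α` = «there exist a Cayley
transform with respect to `α` (in the sense of [16])» (p. 407). [cite: Shelstad1982, §4 pp. 402–407; §1 p. 386] -/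
structure LiftingSetting (G H : Type u) [Group G] [Group H] extends TransferSetting G H where
  /-- The admissible family attached to `ξ` fixed in §4 (p. 402). -/
  Delta : Pair → G → ℂ
  /-- Irreducible tempered representations of `G` (classes). -/
  Rep : Type u
  /-- `χ_π` (a tempered distribution). -/
  charOf : Rep → Module.Dual ℂ SG.schwartz
  /-- `Π_φ` for `φ ∈ Φ₀(G)` (finite, p. 386). -/
  packet : SG.Param → Finset Rep
  /-- `Φ(G*)` (p. 405). -/
  ParamStar : Type u
  /-- «tempered»: `φ(W)` bounded (p. 405). -/
  IsTempered : ParamStar → Prop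
  /-- «relevant to `G`» (p. 405). -/
  RelevantStar : ParamStar → Prop
  /-- `Φ₀(G) ⊂ Φ₀(G*)` (p. 402). -/
  toStar : SG.Param → ParamStar
  /-- `ξ^Φ : Φ₀(H) → Φ₀(G*)` (p. 402). -/
  xiParam : SH.Param → ParamStar
  /-- `ε(π)` of Theorem 4.1.1 for the lift of `χ_{φ′}` (p. 403). -/
  eps : SH.Param → Rep → ℂ
  /-- `χ′ ↦ χ` on characters of `𝔷′`, `𝔷` (p. 403). -/
  infCharLift : SH.InfChar → SG.InfChar
  /-- `𝔛` (p. 405). -/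
  XData : Type u
  /-- `𝔛₀ = {Re μ = 0}` (p. 405). -/
  IsX0 : XData → Prop
  /-- Same `Ω(ᴸG⁰, ᴸT⁰)`-orbit (p. 405). -/
  orbitRel : XData → XData → Prop
  /-- The class of `φ(μ, λ)` in `Φ(G*)` (p. 405). -/
  phiX : XData → ParamStar
  /-- `Ω(𝐆, 𝐓)` for the fixed compact-mod-center `T` (p. 406). -/
  WeylGT : Type u
  /-- Positive systems `Ψ` (p. 406). -/
  PosSys : Type u
  /-- «`μ` is dominant» for `Ψ` (p. 406). -/
  IsDominant : XData → PosSys → Prop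
  /-- `Θ(ωμ, λ, ωΨ)` (p. 406). -/
  Theta : XData → PosSys → WeylGT → Module.Dual ℂ SG.schwartz
  /-- «`Δ^∨_μ` is of type `A₁ × … × A₁`» (p. 406). -/
  IsTypeA1 : XData → Prop
  /-- The imaginary Weyl group of `(𝐆, 𝐓)` (Def. 4.3.6). -/
  ImWeyl : Pair → Type u
  /-- Its action on roots. -/
  imWeylSmul : (p : Pair) → ImWeyl p → Root → Root
  /-- «`α` is compact» (p. 407). -/
  IsCompactRoot : Pair → Root → Prop
  /-- «there exists a Cayley transform with respect to `α`» (p. 407). -/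
  HasCayley : Pair → Root → Prop

namespace LiftingSetting

variable {G H : Type u} [Group G] [Group H] (L : LiftingSetting G H)

/-- **The standing hypothesis of §4 (p. 402)**: `{Δ_(T,η)}` is one of the two admissible families of transfer factors attached to `ξ`
(a family attached to `ξ` that is a set of transfer factors, cf. (3.6)). [cite: Shelstad1982, §4 p. 402; §3.6 p. 401] -/
def StandingHyp : Prop :=
  L.IsXiFamily L.Delta ∧ L.IsTransferFactorFamily L.Delta

/-- **«`Θ(f) = Θ′(f′)`, `f ∈ 𝒞(G)`» (p. 402)**: `Θ` IS THE LIFT of `Θ′` when `Θ(f) = Θ′(f′)` for every pair `(f, f′)` in the correspondence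
determined by `{Δ_(T,η)}` («The family `{Δ_(T,η)}` determines a correspondence `(f, f′)` between the Schwartz spaces `𝒞(G)` and `𝒞(H)`»).
[cite: Shelstad1982, §4 p. 402] -/
def IsLift (Θ' : Module.Dual ℂ L.SH.schwartz) (Θ : Module.Dual ℂ L.SG.schwartz) : Prop :=
  ∀ (f : L.SG.schwartz) (f' : L.SH.schwartz), L.IsMatching L.Delta f f' → Θ f = Θ' f'

/-- **LEMMA 4.0.1 (p. 402).**  «Let `Θ′` be a stable tempered distribution (cf. [14, Sect. 5]) on `H` and set `Θ(f) = Θ′(f′)`, `f ∈ 𝒞(G)`.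
LEMMA 4.0.1. `Θ` is a well-defined invariant tempered distribution on `G`.»  TYPED as its printed contents: `Θ′(f′)` does not depend
on the choice of `f′` corresponding to `f`, and there is an invariant tempered `Θ` on `G` that is the lift of `Θ′` (stability and
invariance = ★ `TemperedSetting.IsStableDist` ∕ `IsInvariantDist` of [Shelstad1979, §5]). [cite: Shelstad1982, Lemma 4.0.1 (p. 402)] -/
def Shelstad1982_4_0_1_liftWellDefined : Prop :=
  L.StandingHyp → ∀ Θ' : Module.Dual ℂ L.SH.schwartz, L.SH.IsStableDist Θ' →
    (∀ (f : L.SG.schwartz) (f'₁ f'₂ : L.SH.schwartz),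
        L.IsMatching L.Delta f f'₁ → L.IsMatching L.Delta f f'₂ → Θ' f'₁ = Θ' f'₂) ∧
      ∃ Θ : Module.Dual ℂ L.SG.schwartz, Θ ∈ L.SG.tempered ∧ L.SG.IsInvariantDist Θ ∧ L.IsLift Θ' Θ

/-- **«`φ` is relevant to `G`» (p. 402)**: for `φ′ ∈ Φ₀(H)` with image `φ = ξ^Φ(φ′) ∈ Φ₀(G*)`, «`φ` lies in the subset `Φ₀(G)` of `Φ₀(G*)`» —
`φ` is the image of a (unique) tempered parameter of `G`. [cite: Shelstad1982, §4.1 p. 402; §4.3 p. 405] -/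
def IsRelevant (φ' : L.SH.Param) : Prop :=
  ∃ φ : L.SG.Param, L.toStar φ = L.xiParam φ'

/-- **THEOREM 4.1.1 (p. 403).**  (Context pp. 402–403: `χ_{φ′} = Σ_{π ∈ Π_{φ′}} χ_π` is stable [14]; «Let `φ` be the image of `φ′` under
the map `ξ^Φ : Φ₀(H) → Φ₀(G)` induced by our fixed embedding».)  «(i) If `φ` is relevant to `G` then the lift of `χ_{φ′}` is
`Σ_{π ∈ Π_φ} ε(π) χ_π`, where each `ε(π)` is a number, either `+1` or `−1`, as defined below [cf. (4.4.3), (4.4.10), and (4.5.1)].  (ii) If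
`φ` is not relevant to `G` then the lift of `χ_{φ′}` is zero.»  (`χ_{φ′}` = `SH.chi φ′` of the ★ dictionary; «the lift» = any `Θ` with
`IsLift`; `Φ₀(G) ↪ Φ₀(G*)` is injective in print, so the `φ` in (i) is the one with `toStar φ = ξ^Φ(φ′)`.) [cite: Shelstad1982, Thm. 4.1.1 (p. 403)] -/
def Shelstad1982_4_1_1_liftOfStableCharacter : Prop :=
  L.StandingHyp → ∀ (φ' : L.SH.Param) (Θ : Module.Dual ℂ L.SG.schwartz), L.IsLift (L.SH.chi φ') Θ →
    (∀ φ : L.SG.Param, L.toStar φ = L.xiParam φ' →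
        (∀ π ∈ L.packet φ, L.eps φ' π = 1 ∨ L.eps φ' π = -1) ∧
          Θ = ∑ π ∈ L.packet φ, L.eps φ' π • L.charOf π) ∧
      (¬ L.IsRelevant φ' → Θ = 0)

/-- **COROLLARY 4.1.2 (p. 403).**  «In the notation of the theorem, `Σ_{π ∈ Π_φ} ε(π) χ_π` vanishes on the Cartan subgroups of `G` not
originating in `H`» — read as functions on `G_reg` (p. 414: «we have … regarded characters as (analytic) functions on `G_reg`»; `F_Θ`
of the ★ dictionary): for `γ ∈ G_reg` whose Cartan subgroup `T_γ` is the origin of no Cartan subgroup of `H`, the function vanishes.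
[cite: Shelstad1982, Cor. 4.1.2 (p. 403); §4.7 (4.7.2)(b) p. 414] -/
def Shelstad1982_4_1_2_vanishingOffOriginating : Prop :=
  L.StandingHyp → ∀ (φ' : L.SH.Param) (φ : L.SG.Param), L.toStar φ = L.xiParam φ' →
    ∀ γ ∈ L.SG.reg, (∀ T' : L.CartanH, ¬ L.cartanOrig T' (L.cartanOfG γ)) →
      L.SG.F (∑ π ∈ L.packet φ, L.eps φ' π • L.charOf π) γ = 0

/-- **LEMMA 4.2.1 (p. 403).**  (Context: `Θ′` a stable tempered distribution on `H`, `Θ` its lift; `z ↦ z′ : 𝔷 → 𝔷′` the homomorphism of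
p. 403 and, for a character `χ′` of `𝔷′`, `χ(z) = χ′(z′)`.)  «If `z′Θ′ = χ′(z′)Θ′`, `z′ ∈ 𝔷′`, then `zΘ = χ(z)Θ`, `z ∈ 𝔷`» — an
eigendistribution lifts to an eigendistribution with the lifted infinitesimal character (★ `TemperedSetting.IsEigen`).
[cite: Shelstad1982, Lemma 4.2.1 (p. 403)] -/
def Shelstad1982_4_2_1_liftIsEigen : Prop :=
  L.StandingHyp → ∀ (Θ' : Module.Dual ℂ L.SH.schwartz) (Θ : Module.Dual ℂ L.SG.schwartz) (χ' : L.SH.InfChar),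
    L.SH.IsStableDist Θ' → L.IsLift Θ' Θ → L.SH.IsEigen Θ' χ' → L.SG.IsEigen Θ (L.infCharLift χ')

/-- **PROPOSITION 4.2.3 (p. 403).**  (Context pp. 403–404: `Θ′` stable tempered with `z′Θ′ = χ′(z′)Θ′`, `Θ` its lift, `F_Θ` the analytic
class function on `G_reg` representing `Θ` via (4.2.2); `T` a Cartan subgroup of `G`.)  «If no Cartan subgroup of `H` originates from `T`
then the restriction of `F_Θ` to `T ∩ G_reg` is zero.» [cite: Shelstad1982, Prop. 4.2.3 (p. 403)] -/
def Shelstad1982_4_2_3_liftVanishesOffOriginating : Prop :=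
  L.StandingHyp → ∀ (Θ' : Module.Dual ℂ L.SH.schwartz) (Θ : Module.Dual ℂ L.SG.schwartz) (χ' : L.SH.InfChar),
    L.SH.IsStableDist Θ' → L.SH.IsEigen Θ' χ' → L.IsLift Θ' Θ →
      ∀ γ ∈ L.SG.reg, (∀ T' : L.CartanH, ¬ L.cartanOrig T' (L.cartanOfG γ)) → L.SG.F Θ γ = 0

/-- **LEMMA 4.3.1 (p. 405).**  «If `φ = φ(μ, λ)` and `φ′ = φ(μ′, λ′)` then `φ′` is equivalent to `φ` if and only if `(μ, λ̲)`, `(μ′, λ̲′)` belong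
to the same orbit» (equivalence = equality of classes in `Φ(G*)`; orbits of `Ω(ᴸG⁰, ᴸT⁰)` on `𝔛`). [cite: Shelstad1982, Lemma 4.3.1 (p. 405)] -/
def Shelstad1982_4_3_1_equivalentIffSameOrbit : Prop :=
  ∀ x x' : L.XData, L.phiX x' = L.phiX x ↔ L.orbitRel x x'

/-- **THEOREM 4.3.2 (p. 406).**  (Context pp. 405–406: `(μ, λ̲) ∈ 𝔛₀` in the orbit `𝒪`, `Ψ` a [some, if `𝒪` is singular] positive system
with respect to which `μ` is dominant, `T` compact modulo the center with p.d. `η` fixed, the distributions `Θ(ωμ, λ, ωΨ)`,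
`ω ∈ Ω(𝐆, 𝐓)`; `φ = φ(μ, λ)`.)  «(4.3.3) If `φ` is not relevant to `G` then each of the distributions `Θ(ωμ, λ, ωΨ)`, `ω ∈ Ω(𝐆,𝐓)`, is zero.
(4.3.4) If `φ` is relevant to `G` then the non-zero distributions in `{Θ(ωμ, λ, ωΨ) : ω ∈ Ω(𝐆,𝐓)}` are exactly the characters of the
representations in the L-packet attached to `{φ}`.» [cite: Shelstad1982, Thm. 4.3.2 (p. 406)] -/
def Shelstad1982_4_3_2_packetCharacters : Prop :=
  ∀ (x : L.XData) (Ψ : L.PosSys), L.IsX0 x → L.IsDominant x Ψ →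
    (¬ L.RelevantStar (L.phiX x) → ∀ ω : L.WeylGT, L.Theta x Ψ ω = 0) ∧
      ∀ φ : L.SG.Param, L.toStar φ = L.phiX x →
        {Θ : Module.Dual ℂ L.SG.schwartz | Θ ≠ 0 ∧ ∃ ω : L.WeylGT, L.Theta x Ψ ω = Θ} =
          (fun π => L.charOf π) '' (L.packet φ : Set L.Rep)

/-- **LEMMA 4.3.5 (p. 406).**  (`Δ^∨_μ = {α^∨ ∈ Δ(ᴸG⁰,ᴸT⁰) : ⟨μ, α^∨⟩ = 0}`.)  «Suppose that `Δ^∨_μ` is of type `A₁ × … × A₁`.  Then (4.3.3) is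
true.» [cite: Shelstad1982, Lemma 4.3.5 (p. 406)] -/
def Shelstad1982_4_3_5_typeA1NotRelevant : Prop :=
  ∀ (x : L.XData) (Ψ : L.PosSys), L.IsX0 x → L.IsDominant x Ψ → L.IsTypeA1 x →
    ¬ L.RelevantStar (L.phiX x) → ∀ ω : L.WeylGT, L.Theta x Ψ ω = 0

/-- **DEFINITION 4.3.6 (p. 407).**  «Let `T` be a Cartan subgroup of `G` and `α` be an imaginary root of `(𝐆, 𝐓)`.  Then `α` is *totally
compact* if and only if each `ωα` is compact, for `ω` in the imaginary Weyl group of `(𝐆, 𝐓)` or, equivalently, for `ω ∈ 𝔄(T)`.»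
(`T` through its pair `(T, η)`; `IsImag` = imaginary.) [cite: Shelstad1982, Def. 4.3.6 (p. 407)] -/
def IsTotallyCompact (p : L.Pair) (α : L.Root) : Prop :=
  L.IsImag p α ∧ ∀ ω : L.ImWeyl p, L.IsCompactRoot p (L.imWeylSmul p ω α)

/-- **p. 407** (after Def. 4.3.6): «A necessary and sufficient condition that there exist a Cayley transform with respect to `α` (in the
sense of [16]) is that `α` not be totally compact (cf. [14])» (`α` an imaginary root). [cite: Shelstad1982, §4.3 p. 407] -/
def Shelstad1982_4_3_cayleyIffNotTotallyCompact : Prop :=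
  ∀ (p : L.Pair), ∀ α ∈ L.roots p, L.IsImag p α → (L.HasCayley p α ↔ ¬ L.IsTotallyCompact p α)

/-- **LEMMA 4.3.7 (p. 407).**  «Suppose that `Δ^∨_μ` is of type `A₁ × … × A₁`.  Then (4.3.4) is true.» [cite: Shelstad1982, Lemma 4.3.7 (p. 407)] -/
def Shelstad1982_4_3_7_typeA1Relevant : Prop :=
  ∀ (x : L.XData) (Ψ : L.PosSys), L.IsX0 x → L.IsDominant x Ψ → L.IsTypeA1 x →
    ∀ φ : L.SG.Param, L.toStar φ = L.phiX x →
      {Θ : Module.Dual ℂ L.SG.schwartz | Θ ≠ 0 ∧ ∃ ω : L.WeylGT, L.Theta x Ψ ω = Θ} =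
        (fun π => L.charOf π) '' (L.packet φ : Set L.Rep)

/-- **(4.7) THEOREM 4.1.1 as a set of character identities (p. 414)** — (4.7.1) and (4.7.2)(b), characters «regarded … as (analytic)
functions on `G_reg`».  «Let `φ′` be a tempered parameter for `H` and `φ` be its lift to `G*`.  Then: (4.7.1) if `φ` is not relevant to
`G` then `Σ_{π ∈ Π_φ} ε(π) χ_π ≡ 0` on all Cartan subgroups of `G`, and (4.7.2) if `φ` is relevant to `G` then … (b) `Σ_{π ∈ Π_φ} ε(π) χ_π ≡ 0`
on those Cartan subgroups of `G` from which no Cartan subgroup of `H` originates.»  READING NOTE: in (4.7.1) `φ ∉ Φ₀(G)` has no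
L-packet for `G`; print's `Σ_{π∈Π_φ} ε(π)χ_π` there is the lift of `χ_{φ′}` (Theorem 4.1.1 (ii)), and (4.7.1) is typed as «the lift
vanishes on `G_reg`»; (4.7.2)(a), the explicit formula on `T ∩ G_reg`, is banked (module doc). [cite: Shelstad1982, §4.7 (4.7.1)–(4.7.2) p. 414] -/
def Shelstad1982_4_7_characterIdentities : Prop :=
  L.StandingHyp → ∀ (φ' : L.SH.Param) (Θ : Module.Dual ℂ L.SG.schwartz), L.IsLift (L.SH.chi φ') Θ →
    (¬ L.IsRelevant φ' → ∀ γ ∈ L.SG.reg, L.SG.F Θ γ = 0) ∧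
      ∀ φ : L.SG.Param, L.toStar φ = L.xiParam φ' →
        ∀ γ ∈ L.SG.reg, (∀ T' : L.CartanH, ¬ L.cartanOrig T' (L.cartanOfG γ)) →
          L.SG.F (∑ π ∈ L.packet φ, L.eps φ' π • L.charOf π) γ = 0

end LiftingSetting

end Literature.NumberTheory.Automorphic.Shelstad1982.TransferAndLifting
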